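import Summits.HubbardSuperconductivity.HubbardSuperconductivity.Theses.BalabanIR

/-!
# Sketch — crux stmt-HubbardSuperconductivity-14846 (`BalabanIR.BirGappedPhaseReductionR`), ideator 1, round 1

First lemmas of the two idea cards of this seat, typed over existing declarations (statements only;
crux-ideate files no skeleton).  Everything is a `def … : Prop` or a plain definition; nothing is proved.

* Card `london-block-coercivity`: `bdgRef` (the d+id Bogoliubov–de Gennes reference of crux 3, as a def),
  `latticeXY`, `blockCorner`, `blockMean`, `blockMisalignment`, the first lemma
  `BdGBlockLondonCoercivity` (Δ-UNIFORM block-scale phase rigidity) and the diagnostic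
  `BdGLatticeConstantIsCondensationScale` (crux 3's best constant is `O(Δ²)`: single-site flip).
* Card `slaved-pair-field-os-dictionary`: `nu4` (U(1)-symmetric four-point surrogate of the complex
  Gaussian), `slavedWeight` (complex weight of a pair-field history), the first lemma
  `SlavedPairFieldTrotter` (exactness of the slaved representation) and `SlavedWeightTimeReflection`
  ((R) for free), plus the Hubbard instance `blockPair`.
-/

namespace Summit.HubbardSuperconductivity.HubbardSuperconductivity.Cruxes.BirGappedPhaseReductionR.Ideator1

open scoped BigOperators Matrix ComplexConjugate Topology
open Filter Literature.Probability.LatticeModels Literature.MathematicalPhysics.QuantumLattice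

noncomputable section

/-! ## The BdG reference of crux 3 as definitions -/

section BdG
variable (μ Δ₁ Δ₂ : ℝ) (L : ℕ) [NeZero L]

/-- nearest neighbours in the `e₁` direction on `(ℤ/L)²`. -/
def nnx (x y : TorusSite 2 L) : Prop := y = x + ![1, 0] ∨ y = x + ![-1, 0]
/-- nearest neighbours in the `e₂` direction. -/
def nny (x y : TorusSite 2 L) : Prop := y = x + ![0, 1] ∨ y = x + ![0, -1]
/-- diagonal neighbours `±(e₁+e₂)`. -/
def dg1 (x y : TorusSite 2 L) : Prop := y = x + ![1, 1] ∨ y = x + ![-1, -1]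
/-- diagonal neighbours `±(e₁-e₂)`. -/
def dg2 (x y : TorusSite 2 L) : Prop := y = x + ![1, -1] ∨ y = x + ![-1, 1]

open Classical in
/-- `h = -(nn adjacency) - μ` (t = 1, t' = 0), verbatim the `h` of `BalabanIR.BirBdGPhaseCoercivity`. -/
def bdgHop : Matrix (TorusSite 2 L) (TorusSite 2 L) ℂ :=
  fun x y => -(if nnx L x y ∨ nny L x y then (1 : ℂ) else 0) - (if x = y then (μ : ℂ) else 0)

open Classical in
/-- the chiral `d+id` bond pairing matrix in the phase texture `θ`, verbatim the `D` of crux 3. -/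
def bdgPair (θ : TorusSite 2 L → ℝ) : Matrix (TorusSite 2 L) (TorusSite 2 L) ℂ :=
  fun x y => ((Δ₁ : ℂ) * ((if nnx L x y then (1 : ℂ) else 0) - (if nny L x y then (1 : ℂ) else 0)) +
      Complex.I * (Δ₂ : ℂ) * ((if dg1 L x y then (1 : ℂ) else 0) - (if dg2 L x y then (1 : ℂ) else 0))) *
    (Complex.exp (Complex.I * (θ x : ℂ)) + Complex.exp (Complex.I * (θ y : ℂ))) / 2

/-- `Hb(θ) = [[h, D(θ)], [D(θ)ᴴ, -h]]`, verbatim the `Hb` of crux 3. -/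
def bdgRef (θ : TorusSite 2 L → ℝ) :
    Matrix (TorusSite 2 L ⊕ TorusSite 2 L) (TorusSite 2 L ⊕ TorusSite 2 L) ℂ :=
  Matrix.fromBlocks (bdgHop μ L) (bdgPair Δ₁ Δ₂ L θ) (bdgPair Δ₁ Δ₂ L θ)ᴴ (-(bdgHop μ L))

open Classical in
/-- crux 3's right-hand side: the LATTICE XY misalignment `Σ_x Σ_{y nn x} (1 - cos(θ_x - θ_y))`. -/
def latticeXY (θ : TorusSite 2 L → ℝ) : ℝ :=
  ∑ x : TorusSite 2 L, ∑ y : TorusSite 2 L, (if nnx L x y ∨ nny L x y then (1 - Real.cos (θ x - θ y)) else 0)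

/-- the corner of the `ℓ × ℓ` block containing `x` (blocks `[kℓ,(k+1)ℓ) × [k'ℓ,(k'+1)ℓ)`, `ℓ ∣ L`). -/
def blockCorner (ℓ : ℕ) (x : TorusSite 2 L) : TorusSite 2 L :=
  ![(((x 0).val / ℓ * ℓ : ℕ) : ZMod L), (((x 1).val / ℓ * ℓ : ℕ) : ZMod L)]

open Classical in
/-- block circular mean `m_b(θ) = ℓ⁻² Σ_{x ∈ b} e^{iθ_x}` (`|m_b| ≤ 1`; `b` a block corner). -/
def blockMean (ℓ : ℕ) (θ : TorusSite 2 L → ℝ) (b : TorusSite 2 L) : ℂ :=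
  (∑ x : TorusSite 2 L, if blockCorner L ℓ x = b then Complex.exp (Complex.I * (θ x : ℂ)) else 0) /
    ((ℓ : ℂ) ^ 2)

open Classical in
/-- the BLOCK (London) misalignment functional `Σ_{⟨b,b'⟩ adjacent blocks} |m_b - m_{b'}|²`
(each adjacent pair once, two lattice directions). -/
def blockMisalignment (ℓ : ℕ) (θ : TorusSite 2 L → ℝ) : ℝ :=
  ∑ b : TorusSite 2 L, if blockCorner L ℓ b = b then
      (‖blockMean L ℓ θ b - blockMean L ℓ θ (b + ![((ℓ : ℕ) : ZMod L), 0])‖ ^ 2 +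
        ‖blockMean L ℓ θ b - blockMean L ℓ θ (b + ![0, ((ℓ : ℕ) : ZMod L)])‖ ^ 2)
    else 0

end BdG

/-- **First lemma of card `london-block-coercivity` (Δ-uniform block-scale phase rigidity of the
BdG reference; the "London limit").**  For every band-interior `μ` there is ONE constant `c(μ) > 0`
and a smallness `Δ₀(μ)` such that for all gaps `0 < |Δ₁|, |Δ₂|`, `|Δ₁| + |Δ₂| ≤ Δ₀`, there is a block
side `ℓ` (intended `ℓ ≍ v_F / gap`) and `L₀` with: for every `L ≥ L₀`, `ℓ ∣ L`, and EVERY lattice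
texture `θ`,  `c · blockMisalignment ℓ θ ≤ Σ|λ(Hb 0)| - Σ|λ(Hb θ)|`.
The constant does NOT degrade with the gap (kinetic/gauge stiffness `~ρ_s(μ)`), in contrast with crux 3's
lattice constant (`BdGLatticeConstantIsCondensationScale`). -/
def BdGBlockLondonCoercivity : Prop :=
  ∀ μ : ℝ, μ ∈ Set.Ioo (-4 : ℝ) 4 → ∃ c : ℝ, 0 < c ∧ ∃ Δ₀ : ℝ, 0 < Δ₀ ∧
    ∀ Δ₁ Δ₂ : ℝ, Δ₁ ≠ 0 → Δ₂ ≠ 0 → |Δ₁| + |Δ₂| ≤ Δ₀ →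
      ∃ ℓ : ℕ, 0 < ℓ ∧ ∃ L₀ : ℕ, ∀ (L : ℕ) [NeZero L], L₀ ≤ L → ℓ ∣ L →
        ∀ θ : TorusSite 2 L → ℝ,
          ∀ (hθ : (bdgRef μ Δ₁ Δ₂ L θ).IsHermitian) (h0 : (bdgRef μ Δ₁ Δ₂ L (fun _ => 0)).IsHermitian),
            c * blockMisalignment L ℓ θ ≤ ∑ i, |h0.eigenvalues i| - ∑ i, |hθ.eigenvalues i|

/-- the single-site `π`-flip texture at `x₀` (its `latticeXY` is `16`). -/
def flipAt {L : ℕ} (x₀ : TorusSite 2 L) : TorusSite 2 L → ℝ :=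
  fun x => if x = x₀ then Real.pi else 0

/-- **Diagnostic of card `london-block-coercivity` (crux 3's constant is condensation-scale).**
The deficit of a single-site `π`-flip is `≤ C(μ)·(Δ₁² + Δ₂²)·(1 + |log(Δ₁² + Δ₂²)|)` while its
lattice XY count is `16`; hence every admissible `c₀` in `BirBdGPhaseCoercivity` obeys
`c₀ ≤ C(Δ₁²+Δ₂²)(1+|log|)/16`, so that at the engine scale (stiffness `K ≍ ρ_s/gap`) the certified
large-field exponent `K·c₀^{eng}` is `O(gap·log) → 0` (toy j015382: `deficit(flip)/(16Δ₁²) ≈ 0.5`). -/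
def BdGLatticeConstantIsCondensationScale : Prop :=
  ∀ μ : ℝ, μ ∈ Set.Ioo (-4 : ℝ) 4 → ∃ C : ℝ, ∀ Δ₁ Δ₂ : ℝ, Δ₁ ≠ 0 → Δ₂ ≠ 0 → |Δ₁| + |Δ₂| ≤ 1 →
    ∃ L₀ : ℕ, ∀ (L : ℕ) [NeZero L], L₀ ≤ L → ∀ x₀ : TorusSite 2 L,
      ∀ (hθ : (bdgRef μ Δ₁ Δ₂ L (flipAt x₀)).IsHermitian) (h0 : (bdgRef μ Δ₁ Δ₂ L (fun _ => 0)).IsHermitian),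
        ∑ i, |h0.eigenvalues i| - ∑ i, |hθ.eigenvalues i| ≤
          C * (Δ₁ ^ 2 + Δ₂ ^ 2) * (1 + |Real.log (Δ₁ ^ 2 + Δ₂ ^ 2)|)
        ∧ latticeXY L (flipAt x₀) = 16

/-! ## The slaved pair field (card `slaved-pair-field-os-dictionary`) -/

section Slaved
variable {n : Type*} [Fintype n] [DecidableEq n]

/-- U(1)-symmetric four-point surrogate of the complex Gaussian of second moment `r²`:
`φ_k = r · i^k`, `k = 0..3` (mean 0, `E φ² = 0`, `E|φ|² = r²`, all third moments `0`). -/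
def nu4 (r : ℝ) (k : Fin 4) : ℂ := (r : ℂ) * Complex.I ^ (k : ℕ)

/-- the Hermitian source slice `exp(aκ(φ̄ B + φ Bᴴ))` (as a Gibbs weight at "inverse temperature" `-aκ`). -/
def sourceSlice (a κ : ℝ) (B : Matrix n n ℂ) (φ : ℂ) : Matrix n n ℂ :=
  Matrix.gibbsWeight (-(a * κ)) ((starRingEnd ℂ φ) • B + φ • Bᴴ)

/-- the penalised ("add") Hamiltonian `H' = H + (κ/2){B, Bᴴ}`. -/
def penalised (κ : ℝ) (H B : Matrix n n ℂ) : Matrix n n ℂ :=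
  H + ((κ / 2 : ℝ) : ℂ) • (B * Bᴴ + Bᴴ * B)

/-- complex weight of a pair-field HISTORY `φs : Fin M → ℂ` at time step `a`:
`W(φ) = tr Π_τ [e^{-aH'} · e^{aκ(φ̄_τ B + φ_τ Bᴴ)}]`. -/
def slavedWeight (a κ : ℝ) (H B : Matrix n n ℂ) (M : ℕ) (φs : Fin M → ℂ) : ℂ :=
  (List.ofFn (fun τ : Fin M => Matrix.gibbsWeight a (penalised κ H B) * sourceSlice a κ B (φs τ))).prod.trace

/-- **(R) for free.** Time-reflection (Osterwalder–Schrader) Hermiticity of the slaved weight: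
`conj W(φ₁,…,φ_M) = W(φ_M,…,φ₁)` whenever `H` is Hermitian (each slice factor is then a product of
two positive matrices).  This is the table-level hypothesis (R) of crux 2R, automatic here. -/
def SlavedWeightTimeReflection : Prop :=
  ∀ (n : Type) [Fintype n] [DecidableEq n] (H B : Matrix n n ℂ), H.IsHermitian →
    ∀ (a κ : ℝ) (M : ℕ) (φs : Fin M → ℂ),
      starRingEnd ℂ (slavedWeight a κ H B M φs) = slavedWeight a κ H B M (φs ∘ Fin.rev)

/-- **First lemma of card `slaved-pair-field-os-dictionary` (exactness of the slaved
representation).**  Add `(κ/2){B,Bᴴ}` to `H` and subtract it by averaging the Hermitian source slice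
over the U(1)-symmetric surrogate Gaussian of second moment `1/(κa)`: in the Trotter limit the
Hubbard(-type) Gibbs trace is recovered EXACTLY,
`tr[(e^{-aH'} · ¼Σ_k e^{aκ(φ̄_k B + φ_k Bᴴ)})^{M}] → tr e^{-βH}` (`a = β/M`), for ANY matrix `B`
(no sign, size or commutation hypothesis on `B`).  Before averaging, the integrand is the complex,
(R)-Hermitian weight `slavedWeight` of a pair-field history; after averaging each slice operator is
positive definite (RP in time). -/
def SlavedPairFieldTrotter : Prop :=
  ∀ (n : Type) [Fintype n] [DecidableEq n] (H B : Matrix n n ℂ), H.IsHermitian →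
    ∀ κ β : ℝ, 0 < κ → 0 < β →
      Tendsto (fun M : ℕ =>
          let a : ℝ := β / ((M : ℝ) + 1)
          let r : ℝ := Real.sqrt (((M : ℝ) + 1) / (κ * β))
          ((Matrix.gibbsWeight a (penalised κ H B) *
              ((1 / 4 : ℂ) • ∑ k : Fin 4, sourceSlice a κ B (nu4 r k))) ^ (M + 1)).trace)
        atTop (𝓝 ((Matrix.gibbsWeight β H).trace))

end Slaved

/-! ## The Hubbard instance of the dictionary -/

section Hubbard
variable (L : ℕ) [NeZero L]

open Classical in
/-- the block `d_{x²-y²}` pair operator `B_b = Σ_{x ∈ block b} P_x` (`P_x = localPair dWaveFormFactor L x`),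
to which the auxiliary block pair field `φ_b` is slaved; `Σ_b B_b = pairField dWaveFormFactor L = Δ_d`. -/
def blockPair (ℓ : ℕ) (b : TorusSite 2 L) :
    Matrix (Finset (Orb (FermionTorus 2 L))) (Finset (Orb (FermionTorus 2 L))) ℂ :=
  ∑ x : TorusSite 2 L, if blockCorner L ℓ x = b then localPair dWaveFormFactor L x else 0

/-- sanity: the blocks tile the torus, so the block pair operators sum to the summit's pair field. -/
def BlockPairsSumToPairField : Prop :=
  ∀ (L : ℕ) [NeZero L] (ℓ : ℕ), 0 < ℓ → ℓ ∣ L →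
    ∑ b : TorusSite 2 L, (if blockCorner L ℓ b = b then blockPair L ℓ b else 0) =
      pairField dWaveFormFactor L

/-- the one-block (`ℓ = L`) instance of the slaved weight for the Hubbard torus in a sector-free form:
`H = hubbardTorus 2 L 1 U`, `B = Δ_d`; its Trotter average is `tr e^{-βH}` by `SlavedPairFieldTrotter`. -/
def hubbardSlavedWeight (U a κ : ℝ) (M : ℕ) (φs : Fin M → ℂ) : ℂ :=
  slavedWeight a κ (hubbardTorus 2 L 1 U) (pairField dWaveFormFactor L) M φs

end Hubbard

end

end Summit.HubbardSuperconductivity.HubbardSuperconductivity.Cruxes.BirGappedPhaseReductionR.Ideator1
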